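import Summits.QuantumFields.YangMills.Theorems.BalabanUVNodesN20KeyedRelWeightSocket

/-!
# BalabanUVNodes ∕ N21 (NE7c) — THE SHELL-WEIGHT SOCKET (twin of module `…N20KeyedRelWeightSocket`): the keyed `T4IndicatorShell.ShellWeightBound` of n19-d's file B
# (`…N19TargetClassWeightsTwoRunKeyed` :185, `h21`) for FIBRE-SUM shell parts ⟸ TERM-LEVEL shell pieces `0 ≤ σ ≤ weight` with two TOTAL relative bounds on the runs'
# (2.18) sequences (converse for the totals); at node U5d's sigma-packed keys VERBATIM

Cell `pub-ymgap` (HUMAN RULING D-0062 Track A; director-ym №197 ∕ HUMAN RULING D-0149 width seats), seat `pub-ymgap-dag-n20-w1` (N20 NE7b WIDTH SEAT 1 of 3) gen 0,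
REBALANCE № 2 of dag-lead g13 DEDUP-358 (D) (pub-ymgap INBOX l.24778: «the SHELL-WEIGHT SOCKET twin of p583724 IF n21-e does not hold it»; dag-n21-e g17 l.24891: not held;
MINE∕YOURS line to dag-n21-w2 l.24919).  Filed `--kind proof --supports stmt-QuantumFields-20544 --as helper` (K3⁷ `SpineGivenEndpointR13SepCoPH`); COUNT-NEUTRAL.
[III] = [Balaban1988Convergent], [LF-I] = [Balaban1989LargeFieldI].

WHY THIS FILE.  Leaf D reads node N21 as ONE binder `h21 : … ShellWeightBound (cr …).l₀ (cr …).T (cr …).A (cr …).B (cr …).shA (cr …).shB (cr …).Wsh`, and n19-d's file B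
(:185) fixes `T ∕ A ∕ B` at node U5d's keys as in module 1 while the SHELL PARTS `shA ∕ shB : ℕ → ℝ → (Σ K, SiteSeqKey F (K₀+K)) → ℝ` stay FREE keyed functions (dag-n20-d's
`ShellSplit₁₃CoPH` at the reading of record).  `ShellWeightBound` (`T4IndicatorShell` :403) asks, per run: keyed shell parts with `0 ≤ sh ≤ weight` ON EVERY CLASS and a TOTAL
relative bound `Σ_{T K} sh ≤ Wsh K · Σ_{T K} weight`, `0 ≤ Wsh`, `Σ Wsh < ∞`.  Where Bałaban's analysis lives — the (2.18) SEQUENCES ([III] (2.18) p. 257) — a shell part is a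
TERM-LEVEL piece `σ K t s` of the term's weight (the integrated shell pieces of the term's indicator slots, `T4IndicatorShell` §2–§3; printed TEMPLATE [LF-I] p. 193); the
keyed shell part is then its FIBRE SUM along the key map, and: termwise `0 ≤ σ ≤ weight` gives the keyed pointwise clauses (fibre sums are monotone), the two TOTAL clauses are
EQUIVALENT to the term-level totals (both sides are full sums, module 1 §1 `sum_keyedFibre_classSet`).  So B's `h21` is fed by ∕ (for the totals) equivalent to displayed
TERM-LEVEL statements — this file; the species arithmetic producing `Wsh` (`T4WeightBudget` §3) and the N21 producers of record (dag-n21-d G17 `…N21DilationRoadEnd`, ROW T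
`…LevelLedgerLinearGrowth.shellWeightBound_of_levels_summable`, dag-n21-w2 `…N21DilationRoadAtRecord13CoPH`) are NOT re-typed: their outputs are what the hypotheses below
display.

CONTENTS (theorems only; 0 `def`, 0 `sorry`; module 1 §1 + Mathlib BY NAME):
* §1 ABSTRACT (module 1's two-source keyed setting + term-level shell pieces `σa ∕ σb`): `keyedFibre_mono` · ★ `shellWeightBound_keyed_of_termShell` · ★ `termShellTotals_of_shellWeightBound_keyed`
  (converse for the totals) · `shellWeightBound_keyed_of_termShellMajorants_slot` (per-run total majorants `S_A, S_B ≤ Wsh` at a pinned slot).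
* §2 AT NODE U5d's SIGMA-PACKED TWO-RUN SITE KEYS (B :185's `h21` VERBATIM with `shA ∕ shB :=` the fibre sums of term-level pieces): ★★ `keyedShellWeight_twoRunKeyed_of_termShell` ·
  ★★ `termShellTotals_of_keyedShellWeight_twoRunKeyed`.

HONEST FRAMING.  Count-neutral kernel bookkeeping (finite sums).  It proves NO estimate: the term-level shell pieces and their bounds for Bałaban's class weights are node N21's
body (NE7c — the cell `pub-balaban`'s OWN estimate, NOT PRINTED for d = 4, NOT PROVED; the (M1) wall `SlotAntiConcentration` at levels `≥ 1` is NODE O's term object) — NAMED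
OPEN, inhabited for no Bałaban family today (A6: LOCATED; `shA = shB := 0`, `Wsh := 0` is the junk inhabitant — content only jointly with N19's core edge); N21 NOT discharged;
K3⁷ NOT closed; no K-item closes; counts unmoved (typed 28∕28 · discharged 5∕27).  One finite `𝕋⁴_{L^K}` programme at fixed `ε = L^{−K}` along two consecutive cutoffs,
Bałaban AS PRINTED; the YM mass gap (Clay) is NOT proved by any of this — R4 closes the conditional finite-𝕋⁴ rung `BalabanLadder.UV` only; nothing continuum ∕ ℝ⁴ ∕ OS.
No `instance`, no `notation`, no `def`.  Sources (locators only): [III] (2.18) p. 257; [LF-I] p. 193; [King1986] (3.10) p. 656.  No decl below carries a cite tag.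
-/

noncomputable section

namespace Summit.QuantumFields.YangMills.BalabanUVNodes.N21KeyedShellWeightSocket

open Literature.MathematicalPhysics.QuantumFieldTheory.Balaban1983to89 Literature.MathematicalPhysics.QuantumFieldTheory.Balaban1983to89.Node00
open scoped BigOperators
open T4Continuum B14.Eq218Concrete Summit.QuantumFields.BalabanUV.T4Continuum.Spine
open T4IndicatorShell (ShellWeightBound)
open Summit.QuantumFields.YangMills.BalabanUVNodes.N20KeyedRelWeightSocket (sum_keyedFibre_classSet keyedFibre_nonneg mem_imageUnion_left mem_imageUnion_right)

/-! ## §1 ABSTRACT: keyed `ShellWeightBound` for fibre-sum shell parts from term-level shell pieces -/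

section Abstract

variable {κ : Type*} [DecidableEq κ]

/-- Fibre sums are monotone in the term weights. [bookkeeping] -/
theorem keyedFibre_mono {σ : Type*} [Fintype σ] (k : σ → κ) {f g : σ → ℝ} (h : ∀ s, f s ≤ g s) (x : κ) :
    ∑ s ∈ Finset.univ.filter (fun s : σ => k s = x), f s ≤ ∑ s ∈ Finset.univ.filter (fun s : σ => k s = x), g s :=
  Finset.sum_le_sum fun s _ => h s

variable {σA σB : ℕ → Type*} [∀ K, Fintype (σA K)] [∀ K, Fintype (σB K)]
  (kA : (K : ℕ) → σA K → κ) (kB : (K : ℕ) → σB K → κ) (a σa : (K : ℕ) → ℝ → σA K → ℝ) (b σb : (K : ℕ) → ℝ → σB K → ℝ)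
  {T : ℕ → Finset κ} {l₀ : ℝ} {Wsh SA SB : ℕ → ℝ}

/-- ★ **THE SHELL SOCKET: KEYED `ShellWeightBound` FOR FIBRE-SUM SHELL PARTS FROM TERM-LEVEL SHELL PIECES.**  Class set `T K` containing every key; keyed weights ∕ shell parts =
the fibre sums of the term weights `a ∕ b` and of the term-level shell pieces `σa ∕ σb` along `kA ∕ kB`.  DISPLAYED: `0 ≤ Wsh`, `Σ Wsh < ∞`; termwise `0 ≤ σa K t s ≤ a K t s`,
`0 ≤ σb ≤ b` (`|t| ≤ l₀`); the two TOTAL relative bounds `Σ_s σa ≤ Wsh K · Σ_s a`, `Σ_{s'} σb ≤ Wsh K · Σ_{s'} b`. [bookkeeping] -/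
theorem shellWeightBound_keyed_of_termShell (hkA : ∀ K s, kA K s ∈ T K) (hkB : ∀ K s', kB K s' ∈ T K)
    (hW0 : ∀ K, 0 ≤ Wsh K) (hWs : Summable Wsh)
    (hσa0 : ∀ K t, |t| ≤ l₀ → ∀ s, 0 ≤ σa K t s) (hσa : ∀ K t, |t| ≤ l₀ → ∀ s, σa K t s ≤ a K t s)
    (hσb0 : ∀ K t, |t| ≤ l₀ → ∀ s', 0 ≤ σb K t s') (hσb : ∀ K t, |t| ≤ l₀ → ∀ s', σb K t s' ≤ b K t s')
    (hA : ∀ K t, |t| ≤ l₀ → ∑ s, σa K t s ≤ Wsh K * ∑ s, a K t s)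
    (hB : ∀ K t, |t| ≤ l₀ → ∑ s', σb K t s' ≤ Wsh K * ∑ s', b K t s') :
    ShellWeightBound l₀ T (fun K t x => ∑ s ∈ Finset.univ.filter (fun s : σA K => kA K s = x), a K t s)
      (fun K t x => ∑ s' ∈ Finset.univ.filter (fun s' : σB K => kB K s' = x), b K t s')
      (fun K t x => ∑ s ∈ Finset.univ.filter (fun s : σA K => kA K s = x), σa K t s)
      (fun K t x => ∑ s' ∈ Finset.univ.filter (fun s' : σB K => kB K s' = x), σb K t s') Wsh where
  nonneg := hW0
  summable := hWs
  sh_nonneg_left K t ht x _ := keyedFibre_nonneg (kA K) (hσa0 K t ht) x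
  sh_le_left K t ht x _ := keyedFibre_mono (kA K) (hσa K t ht) x
  sh_nonneg_right K t ht x _ := keyedFibre_nonneg (kB K) (hσb0 K t ht) x
  sh_le_right K t ht x _ := keyedFibre_mono (kB K) (hσb K t ht) x
  left K t ht := by
    rw [sum_keyedFibre_classSet (kA K) (σa K t) (hkA K), sum_keyedFibre_classSet (kA K) (a K t) (hkA K)]
    exact hA K t ht
  right K t ht := by
    rw [sum_keyedFibre_classSet (kB K) (σb K t) (hkB K), sum_keyedFibre_classSet (kB K) (b K t) (hkB K)]
    exact hB K t ht

/-- ★ **THE CONVERSE FOR THE TOTALS**: a keyed `ShellWeightBound` for the fibre-sum families over a class set containing every key SAYS the two term-level total bounds (both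
sides are full sums).  The keyed pointwise clauses do not in general return termwise ones (a fibre mixes terms); they do on run A, whose key is injective (B §1). [bookkeeping] -/
theorem termShellTotals_of_shellWeightBound_keyed (hkA : ∀ K s, kA K s ∈ T K) (hkB : ∀ K s', kB K s' ∈ T K)
    (h : ShellWeightBound l₀ T (fun K t x => ∑ s ∈ Finset.univ.filter (fun s : σA K => kA K s = x), a K t s)
      (fun K t x => ∑ s' ∈ Finset.univ.filter (fun s' : σB K => kB K s' = x), b K t s')
      (fun K t x => ∑ s ∈ Finset.univ.filter (fun s : σA K => kA K s = x), σa K t s)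
      (fun K t x => ∑ s' ∈ Finset.univ.filter (fun s' : σB K => kB K s' = x), σb K t s') Wsh) :
    (∀ K t, |t| ≤ l₀ → ∑ s, σa K t s ≤ Wsh K * ∑ s, a K t s) ∧
    (∀ K t, |t| ≤ l₀ → ∑ s', σb K t s' ≤ Wsh K * ∑ s', b K t s') := by
  refine ⟨fun K t ht => ?_, fun K t ht => ?_⟩
  · have h' := h.left K t ht
    rwa [sum_keyedFibre_classSet (kA K) (σa K t) (hkA K), sum_keyedFibre_classSet (kA K) (a K t) (hkA K)] at h'
  · have h' := h.right K t ht
    rwa [sum_keyedFibre_classSet (kB K) (σb K t) (hkB K), sum_keyedFibre_classSet (kB K) (b K t) (hkB K)] at h'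

/-- **THE SHELL SOCKET AT A PINNED SLOT FROM PER-RUN TOTAL MAJORANTS** (record-matching form): the runs' OWN total majorants `S_A K`, `S_B K`, nonnegative term weights, and a
slot `Wsh` with `S_A ≤ Wsh`, `S_B ≤ Wsh`, `0 ≤ Wsh`, `Σ Wsh < ∞` ⇒ keyed `ShellWeightBound` at `Wsh`. [bookkeeping] -/
theorem shellWeightBound_keyed_of_termShellMajorants_slot (hkA : ∀ K s, kA K s ∈ T K) (hkB : ∀ K s', kB K s' ∈ T K)
    (ha0 : ∀ K t, |t| ≤ l₀ → ∀ s, 0 ≤ a K t s) (hb0 : ∀ K t, |t| ≤ l₀ → ∀ s', 0 ≤ b K t s')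
    (hσa0 : ∀ K t, |t| ≤ l₀ → ∀ s, 0 ≤ σa K t s) (hσa : ∀ K t, |t| ≤ l₀ → ∀ s, σa K t s ≤ a K t s)
    (hσb0 : ∀ K t, |t| ≤ l₀ → ∀ s', 0 ≤ σb K t s') (hσb : ∀ K t, |t| ≤ l₀ → ∀ s', σb K t s' ≤ b K t s')
    (hA : ∀ K t, |t| ≤ l₀ → ∑ s, σa K t s ≤ SA K * ∑ s, a K t s)
    (hB : ∀ K t, |t| ≤ l₀ → ∑ s', σb K t s' ≤ SB K * ∑ s', b K t s')
    (hWA : ∀ K, SA K ≤ Wsh K) (hWB : ∀ K, SB K ≤ Wsh K) (hW0 : ∀ K, 0 ≤ Wsh K) (hWs : Summable Wsh) :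
    ShellWeightBound l₀ T (fun K t x => ∑ s ∈ Finset.univ.filter (fun s : σA K => kA K s = x), a K t s)
      (fun K t x => ∑ s' ∈ Finset.univ.filter (fun s' : σB K => kB K s' = x), b K t s')
      (fun K t x => ∑ s ∈ Finset.univ.filter (fun s : σA K => kA K s = x), σa K t s)
      (fun K t x => ∑ s' ∈ Finset.univ.filter (fun s' : σB K => kB K s' = x), σb K t s') Wsh :=
  shellWeightBound_keyed_of_termShell kA kB a σa b σb hkA hkB hW0 hWs hσa0 hσa hσb0 hσb
    (fun K t ht => (hA K t ht).trans (mul_le_mul_of_nonneg_right (hWA K) (Finset.sum_nonneg fun s _ => ha0 K t ht s)))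
    (fun K t ht => (hB K t ht).trans (mul_le_mul_of_nonneg_right (hWB K) (Finset.sum_nonneg fun s' _ => hb0 K t ht s')))

end Abstract

/-! ## §2 AT NODE U5d's SIGMA-PACKED TWO-RUN SITE KEYS — n19-d B :185's `h21` binder VERBATIM with fibre-sum shell parts -/

section TwoRunKeyed

variable (F : T4Family) (N : ℕ) [NeZero N] [∀ Kc, DecidableEq (SiteSeqKey F Kc)]

/-- ★★ **LEAF D's `h21` AT B's KEYED DATA FROM TERM-LEVEL SHELL PIECES.**  At the re-pin `ϑ := (θ.liveRepin₁₃ F N).toStage9Params`, for the run families `⟨K₀ + K, mA K, cA K⟩` ∕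
`⟨K₀ + K + 1, mB K, cB K⟩` with histories `gA K` ∕ `gB K` and TERM-LEVEL shell pieces `σa K t s` ∕ `σb K t s'` of the runs' (2.18) sequences: IF `0 ≤ Wsh`, `Σ Wsh < ∞`, termwise
`0 ≤ σ ≤` the class weight, and — THE BODY OF N21, DISPLAYED, NOT PROVED — the total shell piece of run A at cutoff `K₀ + K` is `≤ Wsh K ·` its dressed partition sum and run B's
at `K₀ + K + 1` likewise (uniformly in `|t| ≤ l₀`), THEN the `ShellWeightBound` binder `h21` of B `matching_scheme_of_coreEdge_twoRunKeyed_liveRepin₁₃` (:185) holds VERBATIM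
with `shA ∕ shB :=` the fibre sums of `σa ∕ σb` over `twoRunKeyA ∕ twoRunKeyB`. [bookkeeping] -/
theorem keyedShellWeight_twoRunKeyed_of_termShell (θ : Stage13Params F N) (hM : 0 < θ.τ9.M) (D : FiniteEpsData F (SU N)) (g₀ : ℕ → ℝ) (os : List (ULoop F))
    (K₀ : ℕ) (mA mB : ℕ → ℕ) (cA cB : ℕ → ℝ) (gA gB : ℕ → ℕ → ℝ)
    (σa : (K : ℕ) → ℝ → SeqOfRecord F θ.ν θ.τ9.M (gA K) (K₀ + K) (K₀ + K) → ℝ)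
    (σb : (K : ℕ) → ℝ → SeqOfRecord F θ.ν θ.τ9.M (gB K) (K₀ + K + 1) (K₀ + K + 1) → ℝ)
    {l₀ : ℝ} {Wsh : ℕ → ℝ} (hW0 : ∀ K, 0 ≤ Wsh K) (hWs : Summable Wsh)
    (hσa0 : ∀ K t, |t| ≤ l₀ → ∀ s, 0 ≤ σa K t s)
    (hσa : ∀ K t, |t| ≤ l₀ → ∀ s, σa K t s ≤ classWeightOfDatum₉ F N (θ.liveRepin₁₃ F N).toStage9Params D g₀ os ⟨K₀ + K, mA K, cA K⟩ (gA K) (K₀ + K) t s)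
    (hσb0 : ∀ K t, |t| ≤ l₀ → ∀ s', 0 ≤ σb K t s')
    (hσb : ∀ K t, |t| ≤ l₀ → ∀ s', σb K t s' ≤ classWeightOfDatum₉ F N (θ.liveRepin₁₃ F N).toStage9Params D g₀ os ⟨K₀ + K + 1, mB K, cB K⟩ (gB K) (K₀ + K + 1) t s')
    (hA : ∀ K t, |t| ≤ l₀ →
      ∑ s, σa K t s ≤ Wsh K * ∑ s, classWeightOfDatum₉ F N (θ.liveRepin₁₃ F N).toStage9Params D g₀ os ⟨K₀ + K, mA K, cA K⟩ (gA K) (K₀ + K) t s)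
    (hB : ∀ K t, |t| ≤ l₀ →
      ∑ s', σb K t s' ≤ Wsh K * ∑ s', classWeightOfDatum₉ F N (θ.liveRepin₁₃ F N).toStage9Params D g₀ os ⟨K₀ + K + 1, mB K, cB K⟩ (gB K) (K₀ + K + 1) t s') :
    ShellWeightBound l₀
      (fun K => Finset.univ.image (fun s : SeqOfRecord F θ.ν θ.τ9.M (gA K) (K₀ + K) (K₀ + K) =>
          (⟨K, twoRunKeyA F θ.ν θ.τ9.M (gA K) (K₀ + K) (K₀ + K) s⟩ : Σ K, SiteSeqKey F (K₀ + K)))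
        ∪ Finset.univ.image (fun s' : SeqOfRecord F θ.ν θ.τ9.M (gB K) (K₀ + K + 1) (K₀ + K + 1) =>
          (⟨K, twoRunKeyB F θ.ν hM (gB K) (K₀ + K) (K₀ + K) s'⟩ : Σ K, SiteSeqKey F (K₀ + K))))
      (fun K t x => ∑ s ∈ Finset.univ.filter (fun s : SeqOfRecord F θ.ν θ.τ9.M (gA K) (K₀ + K) (K₀ + K) =>
          (⟨K, twoRunKeyA F θ.ν θ.τ9.M (gA K) (K₀ + K) (K₀ + K) s⟩ : Σ K, SiteSeqKey F (K₀ + K)) = x),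
        classWeightOfDatum₉ F N (θ.liveRepin₁₃ F N).toStage9Params D g₀ os ⟨K₀ + K, mA K, cA K⟩ (gA K) (K₀ + K) t s)
      (fun K t x => ∑ s' ∈ Finset.univ.filter (fun s' : SeqOfRecord F θ.ν θ.τ9.M (gB K) (K₀ + K + 1) (K₀ + K + 1) =>
          (⟨K, twoRunKeyB F θ.ν hM (gB K) (K₀ + K) (K₀ + K) s'⟩ : Σ K, SiteSeqKey F (K₀ + K)) = x),
        classWeightOfDatum₉ F N (θ.liveRepin₁₃ F N).toStage9Params D g₀ os ⟨K₀ + K + 1, mB K, cB K⟩ (gB K) (K₀ + K + 1) t s')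
      (fun K t x => ∑ s ∈ Finset.univ.filter (fun s : SeqOfRecord F θ.ν θ.τ9.M (gA K) (K₀ + K) (K₀ + K) =>
          (⟨K, twoRunKeyA F θ.ν θ.τ9.M (gA K) (K₀ + K) (K₀ + K) s⟩ : Σ K, SiteSeqKey F (K₀ + K)) = x), σa K t s)
      (fun K t x => ∑ s' ∈ Finset.univ.filter (fun s' : SeqOfRecord F θ.ν θ.τ9.M (gB K) (K₀ + K + 1) (K₀ + K + 1) =>
          (⟨K, twoRunKeyB F θ.ν hM (gB K) (K₀ + K) (K₀ + K) s'⟩ : Σ K, SiteSeqKey F (K₀ + K)) = x), σb K t s')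
      Wsh :=
  shellWeightBound_keyed_of_termShell
    (fun K s => (⟨K, twoRunKeyA F θ.ν θ.τ9.M (gA K) (K₀ + K) (K₀ + K) s⟩ : Σ K, SiteSeqKey F (K₀ + K)))
    (fun K s' => (⟨K, twoRunKeyB F θ.ν hM (gB K) (K₀ + K) (K₀ + K) s'⟩ : Σ K, SiteSeqKey F (K₀ + K)))
    (fun K t s => classWeightOfDatum₉ F N (θ.liveRepin₁₃ F N).toStage9Params D g₀ os ⟨K₀ + K, mA K, cA K⟩ (gA K) (K₀ + K) t s) σa
    (fun K t s' => classWeightOfDatum₉ F N (θ.liveRepin₁₃ F N).toStage9Params D g₀ os ⟨K₀ + K + 1, mB K, cB K⟩ (gB K) (K₀ + K + 1) t s') σb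
    (mem_imageUnion_left _ _) (mem_imageUnion_right _ _) hW0 hWs hσa0 hσa hσb0 hσb hA hB

/-- ★★ **THE CONVERSE FOR THE TOTALS AT B's KEYED DATA**: B :185's `h21` with fibre-sum shell parts SAYS the two term-level total bounds. [bookkeeping] -/
theorem termShellTotals_of_keyedShellWeight_twoRunKeyed (θ : Stage13Params F N) (hM : 0 < θ.τ9.M) (D : FiniteEpsData F (SU N)) (g₀ : ℕ → ℝ)
    (os : List (ULoop F)) (K₀ : ℕ) (mA mB : ℕ → ℕ) (cA cB : ℕ → ℝ) (gA gB : ℕ → ℕ → ℝ)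
    (σa : (K : ℕ) → ℝ → SeqOfRecord F θ.ν θ.τ9.M (gA K) (K₀ + K) (K₀ + K) → ℝ)
    (σb : (K : ℕ) → ℝ → SeqOfRecord F θ.ν θ.τ9.M (gB K) (K₀ + K + 1) (K₀ + K + 1) → ℝ) {l₀ : ℝ} {Wsh : ℕ → ℝ}
    (h21 : ShellWeightBound l₀
      (fun K => Finset.univ.image (fun s : SeqOfRecord F θ.ν θ.τ9.M (gA K) (K₀ + K) (K₀ + K) =>
          (⟨K, twoRunKeyA F θ.ν θ.τ9.M (gA K) (K₀ + K) (K₀ + K) s⟩ : Σ K, SiteSeqKey F (K₀ + K)))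
        ∪ Finset.univ.image (fun s' : SeqOfRecord F θ.ν θ.τ9.M (gB K) (K₀ + K + 1) (K₀ + K + 1) =>
          (⟨K, twoRunKeyB F θ.ν hM (gB K) (K₀ + K) (K₀ + K) s'⟩ : Σ K, SiteSeqKey F (K₀ + K))))
      (fun K t x => ∑ s ∈ Finset.univ.filter (fun s : SeqOfRecord F θ.ν θ.τ9.M (gA K) (K₀ + K) (K₀ + K) =>
          (⟨K, twoRunKeyA F θ.ν θ.τ9.M (gA K) (K₀ + K) (K₀ + K) s⟩ : Σ K, SiteSeqKey F (K₀ + K)) = x),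
        classWeightOfDatum₉ F N (θ.liveRepin₁₃ F N).toStage9Params D g₀ os ⟨K₀ + K, mA K, cA K⟩ (gA K) (K₀ + K) t s)
      (fun K t x => ∑ s' ∈ Finset.univ.filter (fun s' : SeqOfRecord F θ.ν θ.τ9.M (gB K) (K₀ + K + 1) (K₀ + K + 1) =>
          (⟨K, twoRunKeyB F θ.ν hM (gB K) (K₀ + K) (K₀ + K) s'⟩ : Σ K, SiteSeqKey F (K₀ + K)) = x),
        classWeightOfDatum₉ F N (θ.liveRepin₁₃ F N).toStage9Params D g₀ os ⟨K₀ + K + 1, mB K, cB K⟩ (gB K) (K₀ + K + 1) t s')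
      (fun K t x => ∑ s ∈ Finset.univ.filter (fun s : SeqOfRecord F θ.ν θ.τ9.M (gA K) (K₀ + K) (K₀ + K) =>
          (⟨K, twoRunKeyA F θ.ν θ.τ9.M (gA K) (K₀ + K) (K₀ + K) s⟩ : Σ K, SiteSeqKey F (K₀ + K)) = x), σa K t s)
      (fun K t x => ∑ s' ∈ Finset.univ.filter (fun s' : SeqOfRecord F θ.ν θ.τ9.M (gB K) (K₀ + K + 1) (K₀ + K + 1) =>
          (⟨K, twoRunKeyB F θ.ν hM (gB K) (K₀ + K) (K₀ + K) s'⟩ : Σ K, SiteSeqKey F (K₀ + K)) = x), σb K t s')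
      Wsh) :
    (∀ K t, |t| ≤ l₀ →
      ∑ s, σa K t s ≤ Wsh K * ∑ s, classWeightOfDatum₉ F N (θ.liveRepin₁₃ F N).toStage9Params D g₀ os ⟨K₀ + K, mA K, cA K⟩ (gA K) (K₀ + K) t s) ∧
    (∀ K t, |t| ≤ l₀ →
      ∑ s', σb K t s' ≤ Wsh K * ∑ s', classWeightOfDatum₉ F N (θ.liveRepin₁₃ F N).toStage9Params D g₀ os ⟨K₀ + K + 1, mB K, cB K⟩ (gB K) (K₀ + K + 1) t s') :=
  termShellTotals_of_shellWeightBound_keyed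
    (fun K s => (⟨K, twoRunKeyA F θ.ν θ.τ9.M (gA K) (K₀ + K) (K₀ + K) s⟩ : Σ K, SiteSeqKey F (K₀ + K)))
    (fun K s' => (⟨K, twoRunKeyB F θ.ν hM (gB K) (K₀ + K) (K₀ + K) s'⟩ : Σ K, SiteSeqKey F (K₀ + K)))
    (fun K t s => classWeightOfDatum₉ F N (θ.liveRepin₁₃ F N).toStage9Params D g₀ os ⟨K₀ + K, mA K, cA K⟩ (gA K) (K₀ + K) t s) σa
    (fun K t s' => classWeightOfDatum₉ F N (θ.liveRepin₁₃ F N).toStage9Params D g₀ os ⟨K₀ + K + 1, mB K, cB K⟩ (gB K) (K₀ + K + 1) t s') σb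
    (mem_imageUnion_left _ _) (mem_imageUnion_right _ _) h21

end TwoRunKeyed

end Summit.QuantumFields.YangMills.BalabanUVNodes.N21KeyedShellWeightSocket

end
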